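import Mathlib
import Summits.NavierStokesRegularity.NavierStokesRegularity.Theorems.EulerZoomLiouvillePowerGaugeEulerLiouvilleSimilarityBernoulliMember
import Summits.NavierStokesRegularity.NavierStokesRegularity.Theorems.EulerZoomLiouvillePowerGaugeEulerLiouvilleDSSSimilarityNodes
import HarnessLib.Audit

/-!
# Crux E `PowerGaugeEulerLiouville` (stmt-NavierStokesRegularity-19832): TAME DISCRETELY SELF-SIMILAR MEMBERS WITH A SUB-BERNOULLI
# PRESSURE CLOCK AND SUBCRITICAL PERMANENT NODES ARE TRIVIAL (key K-A″, DSS version; width seat ns-cas-k2 g2)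

Route `EulerZoomLiouville` (NavierStokesRegularity), crux E.  The DSS form of `…SimilarityBernoulliMember`: for a classical member that
is `l`-DSS for the class scaling (`u(τ,y) = l^{1+ρ}u(l^{2+ρ}τ, ly)`, `l > 1`, `ρ > 0`, `n = 1/(2+ρ)`) and TAME (`u`, `∇u` bounded on compact
time intervals — the binder of the LEAD's `IsDSSClassicalTame`), periodicity makes the member globally Type I with bounded scaled speed
(`…DSSSimilarityTools`), so EVERY backward trajectory is trapped in a moving ball `‖x‖ ≤ R(−s)ⁿ`; under the SUB-BERNOULLI PRESSURE CLOCK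
(`𝒟p ≤ θ(1−2n)‖u + (n/(−s))x‖²`, `θ < 1`) and scale-invariant pressure bounds on the moving balls it comes to REST in similarity variables
(`tendsto_similaritySpeed_zero_of_clock`), clusters on PERMANENT NODES = exactly self-similar particle paths `t ↦ (−t)ⁿy*`
(`…DSSSimilarityNodes`), and if those are SUBCRITICAL (`(−t)⟪∇u(t,(−t)ⁿy*)v,v⟫ ≤ κ‖v‖²`, one `κ < 1` per ball — VACUOUS for a member
without exactly self-similar particle paths, the generic DSS case) its vorticity is killed (`dss_curl_eq_zero_of_confined`).  Hence
`ae_eq_zero_of_gauge_of_dss_of_clock`: crux hypotheses (every `ρ > 0`) + tame `l`-DSS + pressure clock + pressure core bounds + subcritical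
permanent nodes ⇒ `u = 0` a.e. (ns-cas-k2 g0's K-A′ `…MovingSpherePiercing` with BOTH binders discharged: `hS` vacuously by trapping, `hconf`
by the empty confined sets).

WHAT THIS IS NOT: not NS regularity, not the crux E, not the DSS Liouville theorem — DSS members violating the pressure clock somewhere, or
carrying a critical exactly self-similar particle path, are untouched. [folklore; ConstantinIgnatovaVicol2026Putative §3.4.3 (mechanism)]
-/

noncomputable section

set_option linter.dupNamespace false

open MeasureTheory Set Filter Topology Metric Function
open scoped NNReal ENNReal ContDiff InnerProductSpace RealInnerProductSpace

namespace Summit.NavierStokesRegularity.NavierStokesRegularity.Theorems.PowerGaugeEulerLiouville.SimilarityBernoulli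

open Literature.Analysis Literature.Analysis.FluidPDE Literature.Analysis.FunctionSpaces
open Summit.NavierStokesRegularity.NavierStokesRegularity.Theorems.PowerGaugeEulerLiouville.VorticityBirth
open Summit.NavierStokesRegularity.NavierStokesRegularity.Theorems.PowerGaugeEulerLiouville.MovingSpherePiercing

variable {u : ℝ → EuclideanSpace ℝ (Fin 3) → EuclideanSpace ℝ (Fin 3)} {p : ℝ → EuclideanSpace ℝ (Fin 3) → ℝ}
  {n θ ρ l : ℝ}

/-! ### Rest from the pressure clock along a confined trajectory -/

/-- **THE PRESSURE CLOCK BRINGS CONFINED TRAJECTORIES TO REST.**  Classical Euler on `(−∞,0)`, `0 ≤ n < ½`, pressure clock with `θ < 1`;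
a particle path `X` on `(−∞,0)` confined to `‖X(s)‖ ≤ R(−s)ⁿ` for `s ≤ τ₀ < 0`, with `(−s)^{1−n}‖u‖ ≤ A`, `(−s)^{2−2n}p ≤ P₀`,
`(−s)^{2−n}‖∇p‖ ≤ G` along it there.  Then the similarity speed tends to `0` as `s → −∞` (the similarity Bernoulli function is bounded
above by `½A² + P₀ + nRA`, so the speed budget of `…SimilarityBernoulli` holds, and `…SimilarityBernoulliRest` applies). [folklore] -/
theorem tendsto_similaritySpeed_zero_of_clock (hcl : IsClassicalEulerSolutionOn (Iio 0) 0 u p) (hn0 : 0 ≤ n) (hn : n < 1 / 2)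
    (hθ : θ < 1)
    (hclock : ∀ s : ℝ, s < 0 → ∀ x : EuclideanSpace ℝ (Fin 3),
      (-s) * timeDerivWithin (Iio 0) p s x - n * fderiv ℝ (p s) x x - 2 * (1 - n) * p s x ≤
        θ * (1 - 2 * n) * ‖u s x + (n / (-s)) • x‖ ^ 2)
    {X : ℝ → EuclideanSpace ℝ (Fin 3)} {τ₀ R A P₀ G : ℝ} (hτ₀ : τ₀ < 0)
    (hX : ∀ s : ℝ, s < 0 → HasDerivAt X (u s (X s)) s) (hconf : ∀ s : ℝ, s ≤ τ₀ → ‖X s‖ ≤ R * (-s) ^ n)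
    (hA : ∀ s : ℝ, s ≤ τ₀ → (-s) ^ (1 - n) * ‖u s (X s)‖ ≤ A)
    (hP₀ : ∀ s : ℝ, s ≤ τ₀ → (-s) ^ (2 - 2 * n) * p s (X s) ≤ P₀)
    (hG : ∀ s : ℝ, s ≤ τ₀ → (-s) ^ (2 - n) * ‖gradient (p s) (X s)‖ ≤ G) :
    Tendsto (fun s => (-s) ^ (1 - n) * ‖u s (X s) + (n / (-s)) • X s‖) atBot (𝓝 0) := by
  have hR : 0 ≤ R := by
    have h := hconf τ₀ le_rfl
    have hpow : 0 < (-τ₀) ^ n := Real.rpow_pos_of_pos (by linarith) _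
    nlinarith [norm_nonneg (X τ₀)]
  set B : ℝ → ℝ := fun s => (-s) ^ (2 - 2 * n) *
      (‖u s (X s)‖ ^ 2 / 2 + p s (X s) + n * ⟪X s, u s (X s)⟫ / (-s) - n * (1 - 2 * n) / 2 * ‖X s‖ ^ 2 / (-s) ^ 2) with hB
  set Bmax : ℝ := A ^ 2 / 2 + P₀ + n * R * A with hBmax
  have hBle : ∀ s : ℝ, s ≤ τ₀ → B s ≤ Bmax := by
    intro s hs
    have hs0 : 0 < -s := by linarith
    have hsne : (-s) ≠ 0 := hs0.ne'
    have hp : 0 ≤ (-s) ^ (1 - n) := Real.rpow_nonneg hs0.le _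
    have hp2 : 0 ≤ (-s) ^ (2 - 2 * n) := Real.rpow_nonneg hs0.le _
    have e22 : (-s) ^ (2 - 2 * n) = ((-s) ^ (1 - n)) ^ 2 := by
      rw [← Real.rpow_natCast ((-s) ^ (1 - n)) 2, ← Real.rpow_mul hs0.le]; push_cast; ring_nf
    have h1 : (-s) ^ (2 - 2 * n) * (‖u s (X s)‖ ^ 2 / 2) ≤ A ^ 2 / 2 := by
      rw [e22, show ((-s) ^ (1 - n)) ^ 2 * (‖u s (X s)‖ ^ 2 / 2) = ((-s) ^ (1 - n) * ‖u s (X s)‖) ^ 2 / 2 by ring]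
      have := hA s hs
      have h0 : 0 ≤ (-s) ^ (1 - n) * ‖u s (X s)‖ := mul_nonneg hp (norm_nonneg _)
      nlinarith
    have h2 : (-s) ^ (2 - 2 * n) * p s (X s) ≤ P₀ := hP₀ s hs
    have h3 : (-s) ^ (2 - 2 * n) * (n * ⟪X s, u s (X s)⟫ / (-s)) ≤ n * R * A := by
      have hin : ⟪X s, u s (X s)⟫ ≤ ‖X s‖ * ‖u s (X s)‖ := real_inner_le_norm _ _
      have hXR := hconf s hs
      have e : (-s) ^ (2 - 2 * n) / (-s) = (-s) ^ (1 - n) * (-s) ^ (-n) := by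
        rw [← Real.rpow_add hs0, show (1 - n + -n) = (2 - 2 * n) - 1 by ring, Real.rpow_sub_one hsne]
      have epow : (-s) ^ (-n) * (R * (-s) ^ n) = R := by
        rw [show (-s) ^ (-n) * (R * (-s) ^ n) = R * ((-s) ^ (-n) * (-s) ^ n) by ring, ← Real.rpow_add hs0,
          neg_add_cancel, Real.rpow_zero, mul_one]
      have hA0 : 0 ≤ A := (mul_nonneg hp (norm_nonneg _)).trans (hA s hs)
      calc (-s) ^ (2 - 2 * n) * (n * ⟪X s, u s (X s)⟫ / (-s))
          = n * ((-s) ^ (2 - 2 * n) / (-s)) * ⟪X s, u s (X s)⟫ := by ring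
        _ ≤ n * ((-s) ^ (2 - 2 * n) / (-s)) * (‖X s‖ * ‖u s (X s)‖) :=
            mul_le_mul_of_nonneg_left hin (mul_nonneg hn0 (div_nonneg hp2 hs0.le))
        _ = n * (((-s) ^ (-n) * ‖X s‖) * ((-s) ^ (1 - n) * ‖u s (X s)‖)) := by rw [e]; ring
        _ ≤ n * (((-s) ^ (-n) * (R * (-s) ^ n)) * A) := by
            refine mul_le_mul_of_nonneg_left (mul_le_mul (mul_le_mul_of_nonneg_left hXR (Real.rpow_nonneg hs0.le _))
              (hA s hs) (mul_nonneg hp (norm_nonneg _)) ?_) hn0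
            rw [epow]; exact hR
        _ = n * R * A := by rw [epow]; ring
    have h4 : 0 ≤ (-s) ^ (2 - 2 * n) * (n * (1 - 2 * n) / 2 * ‖X s‖ ^ 2 / (-s) ^ 2) := by
      have : 0 ≤ n * (1 - 2 * n) / 2 := by nlinarith
      positivity
    have hsplit : B s = (-s) ^ (2 - 2 * n) * (‖u s (X s)‖ ^ 2 / 2) + (-s) ^ (2 - 2 * n) * p s (X s) +
        (-s) ^ (2 - 2 * n) * (n * ⟪X s, u s (X s)⟫ / (-s)) -
        (-s) ^ (2 - 2 * n) * (n * (1 - 2 * n) / 2 * ‖X s‖ ^ 2 / (-s) ^ 2) := by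
      simp only [hB]; ring
    rw [hsplit, hBmax]
    linarith
  have hcoef : 0 < (1 - θ) * (1 - 2 * n) := mul_pos (by linarith) (by linarith)
  set M : ℝ := (Bmax - B τ₀) / ((1 - θ) * (1 - 2 * n)) with hM
  have hbudget : ∀ a : ℝ, a ≤ τ₀ →
      ∫ s in a..τ₀, (-s) ^ (1 - 2 * n) * ‖u s (X s) + (n / (-s)) • X s‖ ^ 2 ≤ M := by
    intro a ha
    have h : (1 - θ) * (1 - 2 * n) *
        (∫ s in a..τ₀, (-s) ^ (1 - 2 * n) * ‖u s (X s) + (n / (-s)) • X s‖ ^ 2) ≤ B a - B τ₀ :=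
      integral_similaritySpeed_sq_le hcl hclock hX ha hτ₀
    have h2 : B a - B τ₀ ≤ Bmax - B τ₀ := by linarith [hBle a ha]
    rw [hM, le_div_iff₀ hcoef, mul_comm]
    exact h.trans h2
  exact tendsto_similaritySpeed_zero hcl hn0 (by linarith) hτ₀ hX hconf hA hG hbudget

/-! ### DSS: confined trajectories carry no vorticity -/

/-- **DSS: CONFINED BACKWARD TRAJECTORIES CARRY NO VORTICITY.**  `(u,p)` classical on `(−∞,0)`, `l`-DSS for the class scaling
(`ρ > 0`, `n = 1/(2+ρ)`), globally Type I with bounded scaled speed (`(−s)‖∇u‖ ≤ K`, `(−s)^{1−n}‖u‖ ≤ K`), pressure clock with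
`θ < 1`, scale-invariant pressure bounds on the moving ball of radius `R`, and SUBCRITICAL PERMANENT NODES in that ball (`κ < 1`).  If the
backward trajectory of `(τ₀, x₀)` stays in `‖x‖ ≤ R(−s)ⁿ`, then `ω(τ₀, x₀) = 0`. [folklore] -/
theorem dss_curl_eq_zero_of_confined (hcl : IsClassicalEulerSolutionOn (Iio 0) 0 u p) (hρ : 0 < ρ) (hl : 1 < l)
    (hdss : ∀ τ : ℝ, τ < 0 → ∀ y, u τ y = (l ^ (1 + ρ)) • u ((l ^ (2 + ρ)) * τ) (l • y))
    {K : ℝ} (hK : ∀ s : ℝ, s < 0 → ∀ y : EuclideanSpace ℝ (Fin 3),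
      (-s) * ‖fderiv ℝ (u s) y‖ ≤ K ∧ (-s) ^ (1 - (2 + ρ)⁻¹) * ‖u s y‖ ≤ K)
    (hθ : θ < 1)
    (hclock : ∀ s : ℝ, s < 0 → ∀ x : EuclideanSpace ℝ (Fin 3),
      (-s) * timeDerivWithin (Iio 0) p s x - (2 + ρ)⁻¹ * fderiv ℝ (p s) x x - 2 * (1 - (2 + ρ)⁻¹) * p s x ≤
        θ * (1 - 2 * (2 + ρ)⁻¹) * ‖u s x + ((2 + ρ)⁻¹ / (-s)) • x‖ ^ 2)
    {R P₀ G κ : ℝ} (hκ : κ < 1)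
    (hP₀ : ∀ s : ℝ, s < 0 → ∀ x : EuclideanSpace ℝ (Fin 3), ‖x‖ ≤ R * (-s) ^ (2 + ρ)⁻¹ →
      (-s) ^ (2 - 2 * (2 + ρ)⁻¹) * p s x ≤ P₀)
    (hG : ∀ s : ℝ, s < 0 → ∀ x : EuclideanSpace ℝ (Fin 3), ‖x‖ ≤ R * (-s) ^ (2 + ρ)⁻¹ →
      (-s) ^ (2 - (2 + ρ)⁻¹) * ‖gradient (p s) x‖ ≤ G)
    (hnode : ∀ y : EuclideanSpace ℝ (Fin 3), ‖y‖ ≤ R →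
      (∀ t : ℝ, t < 0 → u t ((-t) ^ (2 + ρ)⁻¹ • y) = (-((2 + ρ)⁻¹ * (-t) ^ ((2 + ρ)⁻¹ - 1))) • y) →
      ∀ t : ℝ, t < 0 → ∀ v : EuclideanSpace ℝ (Fin 3),
        (-t) * ⟪fderiv ℝ (u t) ((-t) ^ (2 + ρ)⁻¹ • y) v, v⟫ ≤ κ * ‖v‖ ^ 2)
    {τ₀ : ℝ} (hτ₀ : τ₀ < 0) {x₀ : EuclideanSpace ℝ (Fin 3)}
    (hconf : ∀ s : ℝ, s ≤ τ₀ → ‖ODE.evolutionMap u τ₀ s x₀‖ ≤ R * (-s) ^ (2 + ρ)⁻¹) :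
    curl (u τ₀) x₀ = 0 := by
  have hρ2 : 0 < 2 + ρ := by linarith
  set n : ℝ := (2 + ρ)⁻¹ with hn
  have hn0 : 0 ≤ n := (inv_pos.2 hρ2).le
  have hn2 : n < 1 / 2 := by
    rw [hn, inv_lt_comm₀ hρ2 (by norm_num)]; norm_num; linarith
  have hΛc : ContinuousOn (fun s : ℝ => K / (-s)) (Iio 0) :=
    continuousOn_const.div continuousOn_neg fun s hs => by rw [mem_Iio] at hs; linarith
  have hΛ : ∀ s : ℝ, s < 0 → ∀ y, ‖fderiv ℝ (u s) y‖ ≤ K / (-s) := fun s hs y => by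
    rw [le_div_iff₀ (by linarith), mul_comm]; exact (hK s hs y).1
  have hlip : ODE.IsUniformlyLipschitzOn u (Iio 0) := isUniformlyLipschitzOn hcl hΛc hΛ
  set X : ℝ → EuclideanSpace ℝ (Fin 3) := fun s => ODE.evolutionMap u τ₀ s x₀ with hX
  have hXd : ∀ s : ℝ, s < 0 → HasDerivAt X (u s (X s)) s := fun s hs =>
    hlip.hasDerivAt_evolutionMap (convex_Iio 0) hτ₀ (Iio_mem_nhds hs) x₀
  have hconf' : ∀ s : ℝ, s ≤ τ₀ → ‖X s‖ ≤ R * (-s) ^ n := hconf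
  have hrest := tendsto_similaritySpeed_zero_of_clock hcl hn0 hn2 hθ hclock hτ₀ hXd hconf'
    (fun s hs => (hK s (by linarith) (X s)).2) (fun s hs => hP₀ s (by linarith) (X s) (hconf' s hs))
    (fun s hs => hG s (by linarith) (X s) (hconf' s hs))
  have hκ' : κ < (1 + κ) / 2 := by linarith
  obtain ⟨σ₁, hσ₁τ, hsub⟩ := eventually_subcritical_of_permanentNodes hcl hl hρ2 hdss hκ' hXd hconf' hrest hnode
  have hC : ∀ s : ℝ, s ≤ σ₁ → (-s) * ‖curl (u s) (ODE.evolutionMap u τ₀ s x₀)‖ ≤ 4 * K := by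
    intro s hs
    have hs0 : 0 < -s := by linarith [hs.trans hσ₁τ]
    have h1 := norm_curl_le_four_mul (u s) (X s)
    have h2 := (hK s (by linarith) (X s)).1
    calc (-s) * ‖curl (u s) (X s)‖ ≤ (-s) * (4 * ‖fderiv ℝ (u s) (X s)‖) := mul_le_mul_of_nonneg_left h1 hs0.le
      _ = 4 * ((-s) * ‖fderiv ℝ (u s) (X s)‖) := by ring
      _ ≤ 4 * K := by linarith
  exact curl_eq_zero_of_eventually_subcritical hcl hΛc hΛ hτ₀ hσ₁τ (by linarith : (1 + κ) / 2 < 1) hsub hC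

/-! ### Member level -/

/-- **TAME DSS MEMBERS WITH A SUB-BERNOULLI PRESSURE CLOCK AND SUBCRITICAL PERMANENT NODES ARE TRIVIAL.**  Crux hypotheses verbatim
(EVERY `ρ > 0`) + `(u,p)` classical on the open past + the class DSS law with one factor `l > 1` + TAME (`u`, `∇u` bounded on compact time
intervals) + the pressure clock (`θ < 1`, `n = 1/(2+ρ)`) + for every radius `R > 0`: scale-invariant pressure bounds on the moving ball
(`(−s)^{2−2n}p ≤ P₀`, `(−s)^{2−n}‖∇p‖ ≤ G` — automatic for a DSS pressure) and a constant `κ < 1` making every PERMANENT NODE of the ball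
subcritical (`u(t,(−t)ⁿy*) = −n(−t)^{n−1}y*` for all `t` ⇒ `(−t)⟪∇u(t,(−t)ⁿy*)v,v⟫ ≤ κ‖v‖²`; vacuous if the member has no exactly
self-similar particle path) ⇒ `u = 0` a.e. on `(−∞,0) × ℝ³`. [folklore] -/
theorem ae_eq_zero_of_gauge_of_dss_of_clock (hρ : 0 < ρ)
    {H : ℝ → EuclideanSpace ℝ (Fin 3) → EuclideanSpace ℝ (Fin 3) →L[ℝ] EuclideanSpace ℝ (Fin 3)} {c₀ : ℝ≥0}
    (hsw : IsSuitableWeakSolutionOn (slab (EuclideanSpace ℝ (Fin 3)) (Iio 0) isOpen_Iio) 0 0 u p)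
    (hH : HasWeakSpatialGradientOn (slab (EuclideanSpace ℝ (Fin 3)) (Iio 0) isOpen_Iio) u H)
    (hgauge : ∀ a : ℝ, 0 < a →
      ENNReal.ofReal (a ^ (2 * ρ)) * cknA a (0 : ℝ × EuclideanSpace ℝ (Fin 3)) u +
          ENNReal.ofReal (a ^ ρ) * cknE a (0 : ℝ × EuclideanSpace ℝ (Fin 3)) H +
        ENNReal.ofReal (a ^ (2 * ρ)) * cknD a (0 : ℝ × EuclideanSpace ℝ (Fin 3)) p ≤ (c₀ : ℝ≥0∞))
    (hcl : IsClassicalEulerSolutionOn (Iio 0) 0 u p) (hl : 1 < l)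
    (hdss : ∀ τ : ℝ, τ < 0 → ∀ y, u τ y = (l ^ (1 + ρ)) • u ((l ^ (2 + ρ)) * τ) (l • y))
    (htame : ∀ s t : ℝ, s < t → t < 0 → ∃ B : ℝ, ∀ τ ∈ Icc s t, ∀ y : EuclideanSpace ℝ (Fin 3),
      ‖u τ y‖ ≤ B ∧ ‖fderiv ℝ (u τ) y‖ ≤ B)
    (hθ : θ < 1)
    (hclock : ∀ s : ℝ, s < 0 → ∀ x : EuclideanSpace ℝ (Fin 3),
      (-s) * timeDerivWithin (Iio 0) p s x - (2 + ρ)⁻¹ * fderiv ℝ (p s) x x - 2 * (1 - (2 + ρ)⁻¹) * p s x ≤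
        θ * (1 - 2 * (2 + ρ)⁻¹) * ‖u s x + ((2 + ρ)⁻¹ / (-s)) • x‖ ^ 2)
    (hcore : ∀ R : ℝ, 0 < R → ∃ P₀ G κ : ℝ, κ < 1 ∧
      (∀ s : ℝ, s < 0 → ∀ x : EuclideanSpace ℝ (Fin 3), ‖x‖ ≤ R * (-s) ^ (2 + ρ)⁻¹ →
        (-s) ^ (2 - 2 * (2 + ρ)⁻¹) * p s x ≤ P₀ ∧ (-s) ^ (2 - (2 + ρ)⁻¹) * ‖gradient (p s) x‖ ≤ G) ∧
      (∀ y : EuclideanSpace ℝ (Fin 3), ‖y‖ ≤ R →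
        (∀ t : ℝ, t < 0 → u t ((-t) ^ (2 + ρ)⁻¹ • y) = (-((2 + ρ)⁻¹ * (-t) ^ ((2 + ρ)⁻¹ - 1))) • y) →
        ∀ t : ℝ, t < 0 → ∀ v : EuclideanSpace ℝ (Fin 3),
          (-t) * ⟪fderiv ℝ (u t) ((-t) ^ (2 + ρ)⁻¹ • y) v, v⟫ ≤ κ * ‖v‖ ^ 2)) :
    uncurry u =ᵐ[volume.restrict (Iio (0 : ℝ) ×ˢ (univ : Set (EuclideanSpace ℝ (Fin 3))))] 0 := by
  have hρ2 : 0 < 2 + ρ := by linarith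
  have hl0 : 0 < l := zero_lt_one.trans hl
  have hT1 : 1 < l ^ (2 + ρ) := Real.one_lt_rpow hl hρ2
  have hn0 : 0 < (2 + ρ)⁻¹ := inv_pos.2 hρ2
  obtain ⟨B, hB⟩ := htame (-(l ^ (2 + ρ))) (-1) (by linarith) (by norm_num)
  have hK := exists_typeI_of_dss_tame hl hρ2 (by linarith) hdss hB
  set K : ℝ := l ^ (2 + ρ) * B with hKdef
  have hΛc : ContinuousOn (fun s : ℝ => K / (-s)) (Iio 0) :=
    continuousOn_const.div continuousOn_neg fun s hs => by rw [mem_Iio] at hs; linarith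
  have hΛ : ∀ s : ℝ, s < 0 → ∀ y, ‖fderiv ℝ (u s) y‖ ≤ K / (-s) := fun s hs y => by
    rw [le_div_iff₀ (by linarith), mul_comm]; exact (hK s hs y).1
  refine ae_eq_zero_of_gauge_of_piercing_of_confinedNull_allRho (n := (2 + ρ)⁻¹) hρ hsw hH hgauge hcl hΛc hΛ
    (fun R₀ => ?_) (fun τ₀ hτ₀ R hR => ?_)
  · -- trapping: bounded scaled speed forbids fast inflow on the sphere of radius `R > K/n`
    set R : ℝ := max R₀ (K / (2 + ρ)⁻¹ + 1) with hRdef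
    have hbR : K < (2 + ρ)⁻¹ * R := by
      have h1 : K / (2 + ρ)⁻¹ + 1 ≤ R := le_max_right _ _
      have h2 : K / (2 + ρ)⁻¹ < R := by linarith
      rwa [div_lt_iff₀ hn0, mul_comm] at h2
    refine ⟨R, le_max_left _ _, fun σ hσ x hx hfast => ?_⟩
    exact absurd hfast (not_le.2 (noFastInflow_of_boundedSpeed hσ hbR (fun y _ => (hK σ hσ y).2) hx))
  · obtain ⟨P₀, G, κ, hκ, hPG, hnode⟩ := hcore R hR
    have hempty : {x : EuclideanSpace ℝ (Fin 3) | curl (u τ₀) x ≠ 0 ∧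
        ∀ σ : ℝ, σ ≤ τ₀ → ‖ODE.evolutionMap u τ₀ σ x‖ < R * (-σ) ^ (2 + ρ)⁻¹} = ∅ := by
      refine eq_empty_iff_forall_notMem.2 fun x hx => hx.1 ?_
      exact dss_curl_eq_zero_of_confined hcl hρ hl hdss hK hθ hclock hκ (fun s hs y hy => (hPG s hs y hy).1)
        (fun s hs y hy => (hPG s hs y hy).2) hnode hτ₀ fun s hs => (hx.2 s hs).le
    rw [hempty, measure_empty]

/-! ### Pointwise subcriticality of the permanent nodes suffices (compactness + periodicity) -/

/-- The scaled stretching form at a similarity position is PERIOD-INVARIANT: `F(y, Tᵐt, v) = F(y, t, v)` with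
`F(y,t,v) = (−t)⟪∇u(t,(−t)ⁿy)v, v⟫`. [folklore] -/
theorem stretchingForm_period (hl : 1 < l) (hρ2 : 0 < 2 + ρ)
    (hdss : ∀ τ : ℝ, τ < 0 → ∀ y, u τ y = (l ^ (1 + ρ)) • u ((l ^ (2 + ρ)) * τ) (l • y))
    (m : ℕ) {t : ℝ} (ht : t < 0) (y v : EuclideanSpace ℝ (Fin 3)) :
    (-((l ^ (2 + ρ)) ^ m * t)) * ⟪fderiv ℝ (u ((l ^ (2 + ρ)) ^ m * t))
        ((-((l ^ (2 + ρ)) ^ m * t)) ^ (2 + ρ)⁻¹ • y) v, v⟫ =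
      (-t) * ⟪fderiv ℝ (u t) ((-t) ^ (2 + ρ)⁻¹ • y) v, v⟫ := by
  rw [← stretching_transfer hl hρ2 hdss m ht y v, smul_smul, pow_mul_rpow_eq hl hρ2 m ht]

/-- **POINTWISE SUBCRITICAL PERMANENT NODES ARE UNIFORMLY SUBCRITICAL ON EACH BALL**: for an `l`-DSS classical member, if at every
permanent node `y*` with `‖y*‖ ≤ R` the scaled stretching form is `< ‖v‖²` for all `t < 0`, `v ≠ 0`, then one constant `κ < 1` serves
for the whole ball (the permanent nodes of the ball form a compact set; one period and the unit sphere are compact; the form is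
period-invariant and continuous). [folklore] -/
theorem exists_subcritical_const_of_pointwise (hcl : IsClassicalEulerSolutionOn (Iio 0) 0 u p) (hl : 1 < l) (hρ2 : 0 < 2 + ρ)
    (hdss : ∀ τ : ℝ, τ < 0 → ∀ y, u τ y = (l ^ (1 + ρ)) • u ((l ^ (2 + ρ)) * τ) (l • y)) {R : ℝ}
    (hpt : ∀ y : EuclideanSpace ℝ (Fin 3), ‖y‖ ≤ R →
      (∀ t : ℝ, t < 0 → u t ((-t) ^ (2 + ρ)⁻¹ • y) = (-((2 + ρ)⁻¹ * (-t) ^ ((2 + ρ)⁻¹ - 1))) • y) →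
      ∀ t : ℝ, t < 0 → ∀ v : EuclideanSpace ℝ (Fin 3), v ≠ 0 →
        (-t) * ⟪fderiv ℝ (u t) ((-t) ^ (2 + ρ)⁻¹ • y) v, v⟫ < ‖v‖ ^ 2) :
    ∃ κ : ℝ, κ < 1 ∧ ∀ y : EuclideanSpace ℝ (Fin 3), ‖y‖ ≤ R →
      (∀ t : ℝ, t < 0 → u t ((-t) ^ (2 + ρ)⁻¹ • y) = (-((2 + ρ)⁻¹ * (-t) ^ ((2 + ρ)⁻¹ - 1))) • y) →
      ∀ t : ℝ, t < 0 → ∀ v : EuclideanSpace ℝ (Fin 3),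
        (-t) * ⟪fderiv ℝ (u t) ((-t) ^ (2 + ρ)⁻¹ • y) v, v⟫ ≤ κ * ‖v‖ ^ 2 := by
  set n : ℝ := (2 + ρ)⁻¹ with hn
  set T : ℝ := l ^ (2 + ρ) with hT
  have hT1 : 1 < T := Real.one_lt_rpow hl hρ2
  obtain ⟨PN, hPN⟩ : ∃ PN : Set (EuclideanSpace ℝ (Fin 3)), PN = {y | ‖y‖ ≤ R ∧
    ∀ t : ℝ, t < 0 → u t ((-t) ^ n • y) = (-(n * (-t) ^ (n - 1))) • y} := ⟨_, rfl⟩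
  have hPNc : IsCompact PN := by
    have hclosed : IsClosed {y : EuclideanSpace ℝ (Fin 3) |
        ∀ t : ℝ, t < 0 → u t ((-t) ^ n • y) = (-(n * (-t) ^ (n - 1))) • y} := by
      have e : {y : EuclideanSpace ℝ (Fin 3) | ∀ t : ℝ, t < 0 → u t ((-t) ^ n • y) = (-(n * (-t) ^ (n - 1))) • y} =
          ⋂ t ∈ Iio (0 : ℝ), {y | u t ((-t) ^ n • y) = (-(n * (-t) ^ (n - 1))) • y} := by
        ext y; simp [mem_iInter]
      rw [e]
      refine isClosed_biInter fun t ht => ?_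
      have hu : Continuous (u t) := ((hcl.contDiff_velocity ht).of_le (by norm_cast)).continuous
      exact isClosed_eq (hu.comp (continuous_const_smul ((-t) ^ n))) (continuous_const_smul (-(n * (-t) ^ (n - 1))))
    have h2 : PN = closedBall 0 R ∩ {y : EuclideanSpace ℝ (Fin 3) |
        ∀ t : ℝ, t < 0 → u t ((-t) ^ n • y) = (-(n * (-t) ^ (n - 1))) • y} := by
      rw [hPN]; ext y; simp
    rw [h2]
    exact (isCompact_closedBall _ _).inter_right hclosed
  set S : Set (EuclideanSpace ℝ (Fin 3) × ℝ × EuclideanSpace ℝ (Fin 3)) := PN ×ˢ (Icc (-T) (-1) ×ˢ sphere 0 1) with hS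
  have hSc : IsCompact S := hPNc.prod (isCompact_Icc.prod (isCompact_sphere _ _))
  set F : EuclideanSpace ℝ (Fin 3) × ℝ × EuclideanSpace ℝ (Fin 3) → ℝ :=
    fun z => (-z.2.1) * ⟪fderiv ℝ (u z.2.1) ((-z.2.1) ^ n • z.1) z.2.2, z.2.2⟫ with hF
  have hDcont : ContinuousOn (uncurry fun t x => fderiv ℝ (u t) x) (Iio (0:ℝ) ×ˢ univ) :=
    (hcl.smooth_velocity.fderiv_slice isOpen_Iio.uniqueDiffOn).continuousOn
  have hFc : ContinuousOn F {z | z.2.1 < 0} := by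
    intro z hz
    have hz0 : z.2.1 < 0 := hz
    have ht : ContinuousAt (fun w : EuclideanSpace ℝ (Fin 3) × ℝ × EuclideanSpace ℝ (Fin 3) => w.2.1) z :=
      (continuous_fst.comp continuous_snd).continuousAt
    have hv : ContinuousAt (fun w : EuclideanSpace ℝ (Fin 3) × ℝ × EuclideanSpace ℝ (Fin 3) => w.2.2) z :=
      (continuous_snd.comp continuous_snd).continuousAt
    have hy : ContinuousAt (fun w : EuclideanSpace ℝ (Fin 3) × ℝ × EuclideanSpace ℝ (Fin 3) => (-w.2.1) ^ n • w.1) z :=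
      (ht.neg.rpow_const (Or.inl (by simp; linarith))).smul continuous_fst.continuousAt
    have hpt : ContinuousAt (fun w : EuclideanSpace ℝ (Fin 3) × ℝ × EuclideanSpace ℝ (Fin 3) =>
        ((w.2.1, (-w.2.1) ^ n • w.1) : ℝ × EuclideanSpace ℝ (Fin 3))) z := ht.prodMk hy
    have hA : ContinuousAt (fun w : EuclideanSpace ℝ (Fin 3) × ℝ × EuclideanSpace ℝ (Fin 3) =>
        fderiv ℝ (u w.2.1) ((-w.2.1) ^ n • w.1)) z := by
      have hmem : (z.2.1, (-z.2.1) ^ n • z.1) ∈ Iio (0:ℝ) ×ˢ (univ : Set (EuclideanSpace ℝ (Fin 3))) := ⟨hz0, mem_univ _⟩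
      have h1 := (hDcont _ hmem).continuousAt ((isOpen_Iio.prod isOpen_univ).mem_nhds hmem)
      have h2 : ContinuousAt ((uncurry fun t x => fderiv ℝ (u t) x) ∘
          (fun w : EuclideanSpace ℝ (Fin 3) × ℝ × EuclideanSpace ℝ (Fin 3) =>
            ((w.2.1, (-w.2.1) ^ n • w.1) : ℝ × EuclideanSpace ℝ (Fin 3)))) z := ContinuousAt.comp h1 hpt
      exact h2
    have hAv : ContinuousAt (fun w : EuclideanSpace ℝ (Fin 3) × ℝ × EuclideanSpace ℝ (Fin 3) =>
        fderiv ℝ (u w.2.1) ((-w.2.1) ^ n • w.1) w.2.2) z :=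
      (isBoundedBilinearMap_apply.continuous.continuousAt).comp (hA.prodMk hv)
    exact (ht.neg.mul (hAv.inner hv)).continuousWithinAt
  have hSsub : S ⊆ {z | z.2.1 < 0} := fun z hz => by
    have := hz.2.1.2; show z.2.1 < 0; linarith
  have hreduce : ∀ y ∈ PN, ∀ t : ℝ, t < 0 → ∀ v : EuclideanSpace ℝ (Fin 3), v ≠ 0 →
      ∃ z ∈ S, (-t) * ⟪fderiv ℝ (u t) ((-t) ^ n • y) v, v⟫ = ‖v‖ ^ 2 * F z := by
    intro y hy t ht v hv
    obtain ⟨m, t', ht', hcase⟩ := exists_fundamental_period hT1 ht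
    have ht'0 : t' < 0 := by linarith [ht'.2]
    set w : EuclideanSpace ℝ (Fin 3) := ‖v‖⁻¹ • v with hw
    have hvpos : 0 < ‖v‖ := norm_pos_iff.2 hv
    have hw1 : ‖w‖ = 1 := by
      rw [hw, norm_smul, Real.norm_eq_abs, abs_of_pos (inv_pos.2 hvpos), inv_mul_cancel₀ hvpos.ne']
    have hvw : v = ‖v‖ • w := by rw [hw, smul_smul, mul_inv_cancel₀ hvpos.ne', one_smul]
    have hhom : ∀ s : ℝ, (-s) * ⟪fderiv ℝ (u s) ((-s) ^ n • y) v, v⟫ =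
        ‖v‖ ^ 2 * ((-s) * ⟪fderiv ℝ (u s) ((-s) ^ n • y) w, w⟫) := by
      intro s
      conv_lhs => rw [hvw]
      rw [map_smul, real_inner_smul_left, real_inner_smul_right]
      ring
    refine ⟨(y, t', w), ⟨hy, ht', mem_sphere_zero_iff_norm.2 hw1⟩, ?_⟩
    rw [hhom t]
    congr 1
    simp only [hF]
    rcases hcase with h | h
    · rw [h, hT]; exact stretchingForm_period hl hρ2 hdss m ht'0 y w
    · rw [h, hT]; exact (stretchingForm_period hl hρ2 hdss m ht y w).symm
  rcases S.eq_empty_or_nonempty with hSe | hSne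
  · refine ⟨0, zero_lt_one, fun y hyR hperm t ht v => ?_⟩
    by_cases hv : v = 0
    · simp [hv]
    · obtain ⟨z, hz, -⟩ := hreduce y (by rw [hPN]; exact ⟨hyR, hperm⟩) t ht v hv
      rw [hSe] at hz; exact absurd hz (notMem_empty z)
  · obtain ⟨z₀, hz₀S, hmax⟩ := hSc.exists_isMaxOn hSne (hFc.mono hSsub)
    obtain ⟨hy₀, ht₀, hw₀⟩ := hz₀S
    rw [hPN] at hy₀
    have hw₀1 : ‖z₀.2.2‖ = 1 := mem_sphere_zero_iff_norm.1 hw₀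
    have hF₀ : F z₀ < 1 := by
      have h := hpt z₀.1 hy₀.1 hy₀.2 z₀.2.1 (by linarith [ht₀.2]) z₀.2.2 (by
        rw [← norm_ne_zero_iff, hw₀1]; norm_num)
      rw [hw₀1, one_pow] at h
      exact h
    refine ⟨max (F z₀) 0, max_lt hF₀ zero_lt_one, fun y hyR hperm t ht v => ?_⟩
    by_cases hv : v = 0
    · simp [hv]
    · obtain ⟨z, hz, e⟩ := hreduce y (by rw [hPN]; exact ⟨hyR, hperm⟩) t ht v hv
      rw [e, mul_comm]
      exact mul_le_mul_of_nonneg_right ((hmax hz).trans (le_max_left _ _)) (sq_nonneg _)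

/-- **TAME DSS MEMBERS WITH A SUB-BERNOULLI PRESSURE CLOCK WHOSE EXACTLY SELF-SIMILAR PARTICLE PATHS ARE POINTWISE SUBCRITICAL ARE
TRIVIAL** (`ae_eq_zero_of_gauge_of_dss_of_clock` with the node clause in its sharp pointwise form: at every permanent node `y*`,
`(−t)⟪∇u(t,(−t)ⁿy*)v, v⟫ < ‖v‖²` for all `t < 0`, `v ≠ 0`; vacuous for a member WITHOUT exactly self-similar particle paths). [folklore] -/
theorem ae_eq_zero_of_gauge_of_dss_of_clock_pointwise (hρ : 0 < ρ)
    {H : ℝ → EuclideanSpace ℝ (Fin 3) → EuclideanSpace ℝ (Fin 3) →L[ℝ] EuclideanSpace ℝ (Fin 3)} {c₀ : ℝ≥0}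
    (hsw : IsSuitableWeakSolutionOn (slab (EuclideanSpace ℝ (Fin 3)) (Iio 0) isOpen_Iio) 0 0 u p)
    (hH : HasWeakSpatialGradientOn (slab (EuclideanSpace ℝ (Fin 3)) (Iio 0) isOpen_Iio) u H)
    (hgauge : ∀ a : ℝ, 0 < a →
      ENNReal.ofReal (a ^ (2 * ρ)) * cknA a (0 : ℝ × EuclideanSpace ℝ (Fin 3)) u +
          ENNReal.ofReal (a ^ ρ) * cknE a (0 : ℝ × EuclideanSpace ℝ (Fin 3)) H +
        ENNReal.ofReal (a ^ (2 * ρ)) * cknD a (0 : ℝ × EuclideanSpace ℝ (Fin 3)) p ≤ (c₀ : ℝ≥0∞))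
    (hcl : IsClassicalEulerSolutionOn (Iio 0) 0 u p) (hl : 1 < l)
    (hdss : ∀ τ : ℝ, τ < 0 → ∀ y, u τ y = (l ^ (1 + ρ)) • u ((l ^ (2 + ρ)) * τ) (l • y))
    (htame : ∀ s t : ℝ, s < t → t < 0 → ∃ B : ℝ, ∀ τ ∈ Icc s t, ∀ y : EuclideanSpace ℝ (Fin 3),
      ‖u τ y‖ ≤ B ∧ ‖fderiv ℝ (u τ) y‖ ≤ B)
    (hθ : θ < 1)
    (hclock : ∀ s : ℝ, s < 0 → ∀ x : EuclideanSpace ℝ (Fin 3),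
      (-s) * timeDerivWithin (Iio 0) p s x - (2 + ρ)⁻¹ * fderiv ℝ (p s) x x - 2 * (1 - (2 + ρ)⁻¹) * p s x ≤
        θ * (1 - 2 * (2 + ρ)⁻¹) * ‖u s x + ((2 + ρ)⁻¹ / (-s)) • x‖ ^ 2)
    (hcoreP : ∀ R : ℝ, 0 < R → ∃ P₀ G : ℝ,
      ∀ s : ℝ, s < 0 → ∀ x : EuclideanSpace ℝ (Fin 3), ‖x‖ ≤ R * (-s) ^ (2 + ρ)⁻¹ →
        (-s) ^ (2 - 2 * (2 + ρ)⁻¹) * p s x ≤ P₀ ∧ (-s) ^ (2 - (2 + ρ)⁻¹) * ‖gradient (p s) x‖ ≤ G)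
    (hnodes : ∀ y : EuclideanSpace ℝ (Fin 3),
      (∀ t : ℝ, t < 0 → u t ((-t) ^ (2 + ρ)⁻¹ • y) = (-((2 + ρ)⁻¹ * (-t) ^ ((2 + ρ)⁻¹ - 1))) • y) →
      ∀ t : ℝ, t < 0 → ∀ v : EuclideanSpace ℝ (Fin 3), v ≠ 0 →
        (-t) * ⟪fderiv ℝ (u t) ((-t) ^ (2 + ρ)⁻¹ • y) v, v⟫ < ‖v‖ ^ 2) :
    uncurry u =ᵐ[volume.restrict (Iio (0 : ℝ) ×ˢ (univ : Set (EuclideanSpace ℝ (Fin 3))))] 0 := by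
  refine ae_eq_zero_of_gauge_of_dss_of_clock hρ hsw hH hgauge hcl hl hdss htame hθ hclock fun R hR => ?_
  obtain ⟨P₀, G, hPG⟩ := hcoreP R hR
  obtain ⟨κ, hκ, hnode⟩ := exists_subcritical_const_of_pointwise hcl hl (by linarith) hdss (R := R)
    fun y _ hperm => hnodes y hperm
  exact ⟨P₀, G, κ, hκ, hPG, hnode⟩

end Summit.NavierStokesRegularity.NavierStokesRegularity.Theorems.PowerGaugeEulerLiouville.SimilarityBernoulli

end
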